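import Summits.ValiantsHypothesis.ValiantsHypothesis.Theorems.BarrierLeverChowBenchmarkPairsBlockPeelLabels

/-!
# Route BarrierLever — item 22038 `ChowBenchmarkPairs`, line `moore-peel`: the BLOCK PEEL, III — STAGE
# REDUCTION I (tied substitution `Y_{n+s} ↦ Λ_s·X`, scaling of the attached block rows, reduction against the
# fixed rows)

Helper file (`--supports stmt-ValiantsHypothesis-22038`; cell valiant-natproofs, rung V4, 𝒟-side benchmark of
record, line `moore_peel`, planner kernel target **K1** (HOME/STATUS.md l.1746); seat val-np-p4 gen 29).
Closes NO item; definition-free.  The `t`-point verbatim analogue of `linearIndependent_krow_of_reduced` of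
`…KernelPeelStage` (memo `HOME/val-np-p4/g28/memo/MEMO-valnp4-g28.md` §1), with the labels and reduced rows of
`…BlockPeelLabels`.

* **`linearIndependent_krow_of_blockReduced`** — over any commutative ring `R`: if the reduced rows
  `kblockReducedRow κ r i n Y` at stage `(i, n+t)` are linearly independent over `R[X]`, so are the substituted
  rows `krow κ r Z` for every node table `Z` with `Z b = C (Y b) · X` on the block (`n ≤ b < n+t`) and
  `Z c = C (Y c)` for `c < n` (scaling by the diagonal `X^q` via `linearIndependent_of_block'`, reduction via
  `linearIndependent_of_sub_fixed'`, closed forms `krow_single_tied_sub_fixed` / `krow_pair_tied_tied_sub_fixed` /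
  `krow_pair_fixed_tied_sub_fixed` of `…BlockPeelRows`).

WHAT THIS IS NOT: no stub of line `moore_peel` is closed; `stub_segmentMeanValue` (∀ h) is untouched; nothing
on crux stmt-ValiantsHypothesis-14610 or on `VP` versus `VNP`.
-/

set_option linter.dupNamespace false

namespace Summit.ValiantsHypothesis.ValiantsHypothesis.Theorems.BarrierLever.MoorePeel

open Polynomial Finset


/-- **STAGE REDUCTION I** (block peel).  Over any commutative ring `R`: if the reduced rows
`kblockReducedRow κ r i n Y` at stage `(i, n+t)` are linearly independent over `R[X]`, then so are the
substituted rows `krow κ r Z` for every node table `Z` with `Z b = C (Y b) · X` for `n ≤ b < n + t` and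
`Z c = C (Y c)` for `c < n`. -/
theorem linearIndependent_krow_of_blockReduced {R : Type*} [CommRing R] (κ : ℕ → ℕ) (r i n t : ℕ)
    (Y : ℕ → R) (Z : ℕ → R[X]) (hZt : ∀ b, n ≤ b → b < n + t → Z b = C (Y b) * X)
    (hZlt : ∀ b, b < n → Z b = C (Y b))
    (hred : LinearIndependent R[X]
      (fun x : ↥(stageRows i (n + t)) => kblockReducedRow κ r i n Y (x : RowLabel))) :
    LinearIndependent R[X] (fun x : ↥(stageRows i (n + t)) => krow κ r Z (x : RowLabel)) := by
  classical
  -- the three kinds of labels alive at stage `(i, n+t)`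
  set ιB : BlockIdx i t → ↥(stageRows i (n + t)) := fun ρ => ⟨blockLabel i n ρ, blockLabel_mem ρ⟩ with hιB
  set ιE : Fin n × Fin t → ↥(stageRows i (n + t)) := fun cs => ⟨extLabel n cs, extLabel_mem cs⟩ with hιE
  have hιBinj : Function.Injective ιB := fun ρ ρ' e => blockLabel_injective (congrArg Subtype.val e)
  have hιBval : ∀ ρ, ((ιB ρ : ↥(stageRows i (n + t))) : RowLabel) = blockLabel i n ρ := fun ρ => rfl
  have hιEval : ∀ cs, ((ιE cs : ↥(stageRows i (n + t))) : RowLabel) = extLabel n cs := fun cs => rfl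
  have htri : ∀ x : ↥(stageRows i (n + t)), (x : RowLabel) ∈ stageRows i n ∨
      (∃ ρ, x = ιB ρ) ∨ (∃ cs, x = ιE cs) := by
    rintro ⟨x, hx⟩
    rcases stageRows_trichotomy x hx with h | ⟨ρ, rfl⟩ | ⟨cs, rfl⟩
    · exact Or.inl h
    · exact Or.inr (Or.inl ⟨ρ, rfl⟩)
    · exact Or.inr (Or.inr ⟨cs, rfl⟩)
  have hιB_not_fixed : ∀ ρ, ((ιB ρ : ↥(stageRows i (n + t))) : RowLabel) ∉ stageRows i n :=
    fun ρ => blockLabel_not_mem ρ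
  have hιE_not_fixed : ∀ cs, ((ιE cs : ↥(stageRows i (n + t))) : RowLabel) ∉ stageRows i n :=
    fun cs => extLabel_not_mem cs
  have hιE_not_range : ∀ cs, ιE cs ∉ Set.range ιB := by
    rintro cs ⟨ρ, e⟩
    exact extLabel_ne_blockLabel cs ρ (congrArg Subtype.val e).symm
  have hfixed_not_range : ∀ x : ↥(stageRows i (n + t)), (x : RowLabel) ∈ stageRows i n →
      x ∉ Set.range ιB := by
    rintro x hx ⟨ρ, rfl⟩
    exact hιB_not_fixed ρ hx
  -- the tied points
  have hZB : ∀ s : Fin t, Z (n + (s : ℕ)) = C (Y (n + (s : ℕ))) * X :=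
    fun s => hZt _ (by omega) (by have := s.2; omega)
  -- STEP 1: scale the attached block rows `(T_q, {b})` by `X^q`
  obtain ⟨sc, hsc⟩ : ∃ sc : ↥(stageRows i (n + t)) → R[X], ∀ x, sc x =
      Sum.elim (fun _ => (1 : R[X]))
        (Sum.elim (fun jb : ℕ × ℕ => if n ≤ jb.2 then Polynomial.X ^ jb.1 else 1) (fun _ => 1))
        (x : RowLabel) := ⟨_, fun _ => rfl⟩
  obtain ⟨V1, hV1⟩ : ∃ V1 : ↥(stageRows i (n + t)) → Fin r → R[X],
      ∀ x, V1 x = sc x • krow κ r Z (x : RowLabel) := ⟨_, fun _ => rfl⟩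
  have hscB : ∀ ρ : BlockIdx i t, sc (ιB ρ) = if (ρ.2 : ℕ) < i then Polynomial.X ^ (ρ.2 : ℕ) else 1 := by
    intro ρ
    rw [hsc, hιBval]
    by_cases hq : (ρ.2 : ℕ) < i
    · rw [blockLabel_of_lt ρ hq, if_pos hq]
      simp
    · rw [blockLabel_of_not_lt ρ hq, if_neg hq]
      simp
  have hscoff : ∀ x, x ∉ Set.range ιB → sc x = 1 := by
    intro x hx
    rw [hsc]
    rcases htri x with hfx | ⟨ρ, rfl⟩ | ⟨cs, rfl⟩
    · obtain ⟨y, hy⟩ := x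
      rcases y with m | ⟨j, b⟩ | ⟨b, b'⟩
      · simp
      · have hb : ¬ n ≤ b := not_le.mpr (inr_inl_mem_stageRows.mp hfx).2
        simp [hb]
      · simp
    · exact absurd (Set.mem_range_self ρ) hx
    · simp [hιE, extLabel]
  have hV1off : ∀ x, x ∉ Set.range ιB → V1 x = krow κ r Z (x : RowLabel) := by
    intro x hx
    rw [hV1, hscoff x hx, one_smul]
  apply linearIndependent_of_block' _ V1 ιB hιBinj
    (Matrix.diagonal fun ρ : BlockIdx i t => if (ρ.2 : ℕ) < i then (Polynomial.X : R[X]) ^ (ρ.2 : ℕ) else 1)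
    (Matrix.diagonal fun ρ : BlockIdx i t =>
      if (ρ.2 : ℕ) < i then (Polynomial.X : R[X]) ^ (i - (ρ.2 : ℕ)) else Polynomial.X ^ i)
    (Polynomial.X ^ i)
    (fun x hx => (Polynomial.monic_X_pow i).mul_right_eq_zero_iff.mp hx)
  · rw [Matrix.diagonal_mul_diagonal, Matrix.smul_one_eq_diagonal]
    congr 1
    funext ρ
    split_ifs with hq
    · rw [← pow_add, Nat.sub_add_cancel (le_of_lt hq)]
    · rw [mul_one]
  · intro ρ'
    have hdiag : ∀ ρ : BlockIdx i t,
        (Matrix.diagonal (fun ρ : BlockIdx i t =>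
          if (ρ.2 : ℕ) < i then (Polynomial.X : R[X]) ^ (ρ.2 : ℕ) else 1) ρ' ρ) •
          krow κ r Z ((ιB ρ : ↥(stageRows i (n + t))) : RowLabel) =
        if ρ = ρ' then sc (ιB ρ') • krow κ r Z ((ιB ρ' : ↥(stageRows i (n + t))) : RowLabel)
        else 0 := by
      intro ρ
      by_cases hρ : ρ = ρ'
      · subst hρ
        rw [Matrix.diagonal_apply_eq, if_pos rfl, hscB]
      · rw [Matrix.diagonal_apply_ne _ (Ne.symm hρ), zero_smul, if_neg hρ]
    rw [hV1, Finset.sum_congr rfl (fun ρ _ => hdiag ρ), Finset.sum_ite_eq' Finset.univ ρ',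
      if_pos (Finset.mem_univ _)]
  · exact hV1off
  -- STEP 2: subtract the fixed rows (monomial rows `e_m`, attached rows `(T_j', {c})`)
  set F : Finset ↥(stageRows i (n + t)) :=
    Finset.univ.filter fun x => (x : RowLabel) ∈ stageRows i n with hF
  have hmemF : ∀ x : ↥(stageRows i (n + t)), x ∈ F ↔ (x : RowLabel) ∈ stageRows i n := fun x => by
    simp [hF]
  set eL : Fin (windowStart i) ⊕ (Fin i × Fin n) → ↥(stageRows i (n + t)) := fun l =>
    Sum.elim (fun m : Fin (windowStart i) =>
        (⟨Sum.inl (m : ℕ), inl_mem_stageRows.mpr m.2⟩ : ↥(stageRows i (n + t))))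
      (fun jc : Fin i × Fin n => (⟨Sum.inr (Sum.inl ((jc.1 : ℕ), (jc.2 : ℕ))),
        inr_inl_mem_stageRows.mpr ⟨jc.1.2, by have := jc.2.2; omega⟩⟩ : ↥(stageRows i (n + t))))
      l with heL
  have heF : ∀ l, eL l ∈ F := by
    intro l
    rw [hmemF]
    rcases l with m | ⟨j, c⟩
    · simp only [heL, Sum.elim_inl]
      exact inl_mem_stageRows.mpr m.2
    · simp only [heL, Sum.elim_inr]
      exact inr_inl_mem_stageRows.mpr ⟨j.2, c.2⟩
  have heL_not_range : ∀ l, eL l ∉ Set.range ιB := fun l =>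
    hfixed_not_range _ ((hmemF _).mp (heF l))
  obtain ⟨π, hπ⟩ : ∃ π : ↥(stageRows i (n + t)) → Fin (windowStart i) ⊕ (Fin i × Fin n) → R[X],
      ∀ x l, π x l =
      Sum.elim (fun _ => (0 : R[X]))
        (Sum.elim
          (fun jb : ℕ × ℕ => if n ≤ jb.2 then
            Sum.elim (fun m : Fin (windowStart i) =>
              Polynomial.C (((kincl κ jb.1 (m : ℕ) : ℕ) : R) * Y jb.2 ^ ((m : ℕ) - jb.1)) *
                Polynomial.X ^ (m : ℕ))
              (fun _ => 0) l else 0)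
          (fun bb : ℕ × ℕ => if n ≤ bb.1 then
            Sum.elim (fun m : Fin (windowStart i) =>
              Polynomial.C (pairCoef κ (Y bb.1) (Y bb.2) (m : ℕ)) * Polynomial.X ^ (m : ℕ))
              (fun _ => 0) l
            else if n ≤ bb.2 then
            Sum.elim (fun _ => (0 : R[X]))
              (fun jc : Fin i × Fin n => if (jc.2 : ℕ) = bb.1 then
                Polynomial.C ((((κ (bits (jc.1 : ℕ)).card : ℕ) : R)) * Y bb.2 ^ (jc.1 : ℕ)) *
                  Polynomial.X ^ (jc.1 : ℕ) else 0) l else 0))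
        (x : RowLabel) := ⟨_, fun _ _ => rfl⟩
  obtain ⟨V2, hV2⟩ : ∃ V2 : ↥(stageRows i (n + t)) → Fin r → R[X],
      ∀ x, V2 x = if x ∈ F then V1 x else V1 x - ∑ l, π x l • V1 (eL l) := ⟨_, fun _ => rfl⟩
  apply linearIndependent_of_sub_fixed' V1 F eL heF π
  rw [show (fun k => if k ∈ F then V1 k else V1 k - ∑ l, π k l • V1 (eL l)) = V2 from
    (funext hV2).symm]
  -- values of `V1` on the subtracted rows
  have hV1eL_inl : ∀ (m : Fin (windowStart i)) (col : Fin r),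
      V1 (eL (Sum.inl m)) col = if (col : ℕ) = (m : ℕ) then (1 : R[X]) else 0 := by
    intro m col
    rw [hV1off _ (heL_not_range _)]
    simp [heL, krow]
  have hV1eL_inr : ∀ (jc : Fin i × Fin n) (col : Fin r),
      V1 (eL (Sum.inr jc)) col = Polynomial.C (krow κ r Y (Sum.inr (Sum.inl ((jc.1 : ℕ), (jc.2 : ℕ)))) col) := by
    intro jc col
    rw [hV1off _ (heL_not_range _)]
    simp only [heL, Sum.elim_inr]
    exact krow_eq_C_of_mem_stageRows κ r Y Z i n hZlt _ (inr_inl_mem_stageRows.mpr ⟨jc.1.2, jc.2.2⟩) col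
  -- closed forms of the reduced rows
  have hV2fixed : ∀ x : ↥(stageRows i (n + t)), (x : RowLabel) ∈ stageRows i n →
      V2 x = fun col => Polynomial.C (krow κ r Y (x : RowLabel) col) := by
    intro x hx
    rw [hV2, if_pos ((hmemF x).mpr hx), hV1off x (hfixed_not_range x hx)]
    funext col
    exact krow_eq_C_of_mem_stageRows κ r Y Z i n hZlt x hx col
  have hV2B : ∀ ρ : BlockIdx i t, V2 (ιB ρ) = kblockReducedRow κ r i n Y (blockLabel i n ρ) := by
    intro ρ
    rw [hV2, if_neg (fun hm => hιB_not_fixed ρ ((hmemF _).mp hm)), kblockReducedRow_blockLabel]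
    funext col
    simp only [Pi.sub_apply, Finset.sum_apply, Pi.smul_apply, smul_eq_mul]
    rw [Fintype.sum_sum_type]
    have h2 : ∑ jc : Fin i × Fin n, π (ιB ρ) (Sum.inr jc) * V1 (eL (Sum.inr jc)) col = 0 :=
      Finset.sum_eq_zero fun jc _ => by
        rw [hπ, hιBval]
        by_cases hq : (ρ.2 : ℕ) < i
        · rw [blockLabel_of_lt ρ hq]; simp
        · rw [blockLabel_of_not_lt ρ hq]; simp
    rw [h2, add_zero, hV1 (ιB ρ)]
    simp only [Pi.smul_apply, smul_eq_mul]
    by_cases hq : (ρ.2 : ℕ) < i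
    · rw [hscB, if_pos hq, hιBval, blockLabel_of_lt ρ hq, blockEntry, if_pos hq,
        ← krow_single_tied_sub_fixed κ r Z (n + (ρ.1 : ℕ)) (Y (n + (ρ.1 : ℕ))) (hZB ρ.1) i (ρ.2 : ℕ) col,
        ← Fin.sum_univ_eq_sum_range (fun m =>
          (C (((kincl κ (ρ.2 : ℕ) m : ℕ) : R) * Y (n + (ρ.1 : ℕ)) ^ (m - (ρ.2 : ℕ))) * X ^ m) *
            (if (col : ℕ) = m then (1 : R[X]) else 0)) (windowStart i)]
      congr 1
      refine Finset.sum_congr rfl fun m _ => ?_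
      rw [hπ, hιBval, blockLabel_of_lt ρ hq, hV1eL_inl]
      simp
    · rw [hscB, if_neg hq, one_mul, hιBval, blockLabel_of_not_lt ρ hq, blockEntry, if_neg hq,
        ← krow_pair_tied_tied_sub_fixed κ r Z (n + ((ρ.2 : ℕ) - i)) (n + (ρ.1 : ℕ))
          (Y (n + ((ρ.2 : ℕ) - i))) (Y (n + (ρ.1 : ℕ)))
          (hZt _ (by omega) (by have := ρ.2.2; have := ρ.1.2; omega)) (hZB ρ.1) i col,
        ← Fin.sum_univ_eq_sum_range (fun m =>
          (C (pairCoef κ (Y (n + ((ρ.2 : ℕ) - i))) (Y (n + (ρ.1 : ℕ))) m) * X ^ m) *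
            (if (col : ℕ) = m then (1 : R[X]) else 0)) (windowStart i)]
      congr 1
      refine Finset.sum_congr rfl fun m _ => ?_
      rw [hπ, hιBval, blockLabel_of_not_lt ρ hq, hV1eL_inl]
      simp
  have hV2E : ∀ cs : Fin n × Fin t, V2 (ιE cs) = kblockReducedRow κ r i n Y (extLabel n cs) := by
    intro cs
    have hc : ¬ n ≤ (cs.1 : ℕ) := not_le.mpr cs.1.2
    rw [hV2, if_neg (fun hm => hιE_not_fixed cs ((hmemF _).mp hm)), kblockReducedRow_extLabel,
      hV1off _ (hιE_not_range cs)]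
    funext col
    rw [hιEval, extLabel,
      ← krow_pair_fixed_tied_sub_fixed κ r Y Z (cs.1 : ℕ) (n + (cs.2 : ℕ)) i (hZlt _ cs.1.2) (hZB cs.2) col]
    simp only [Pi.sub_apply, Finset.sum_apply, Pi.smul_apply, smul_eq_mul]
    congr 1
    rw [Fintype.sum_sum_type]
    have h1 : ∑ m : Fin (windowStart i), π (ιE cs) (Sum.inl m) * V1 (eL (Sum.inl m)) col = 0 :=
      Finset.sum_eq_zero fun m _ => by rw [hπ, hιEval, extLabel]; simp [hc]
    rw [h1, zero_add, Fintype.sum_prod_type,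
      ← Fin.sum_univ_eq_sum_range (fun j' =>
        (Polynomial.C ((((κ (bits j').card : ℕ) : R)) * Y (n + (cs.2 : ℕ)) ^ j') * Polynomial.X ^ j') *
          Polynomial.C (krow κ r Y (Sum.inr (Sum.inl (j', (cs.1 : ℕ)))) col)) i]
    refine Finset.sum_congr rfl fun j' _ => ?_
    have hval : ∀ c' : Fin n, π (ιE cs) (Sum.inr (j', c')) * V1 (eL (Sum.inr (j', c'))) col =
        if c' = cs.1 then (Polynomial.C ((((κ (bits (j' : ℕ)).card : ℕ) : R)) *
          Y (n + (cs.2 : ℕ)) ^ (j' : ℕ)) * Polynomial.X ^ (j' : ℕ)) *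
            Polynomial.C (krow κ r Y (Sum.inr (Sum.inl ((j' : ℕ), (cs.1 : ℕ)))) col) else 0 := by
      intro c'
      rw [hπ, hιEval, extLabel, hV1eL_inr]
      simp only [Sum.elim_inr, hc, if_false, le_add_iff_nonneg_right, zero_le, if_true]
      by_cases hc' : c' = cs.1
      · subst hc'
        simp
      · have : (c' : ℕ) ≠ (cs.1 : ℕ) := fun e => hc' (Fin.ext e)
        simp [hc', this]
    simp_rw [hval]
    rw [Finset.sum_ite_eq' Finset.univ cs.1, if_pos (Finset.mem_univ _)]
  -- the reduced family is `kblockReducedRow`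
  have hV2eq : V2 = fun x : ↥(stageRows i (n + t)) => kblockReducedRow κ r i n Y (x : RowLabel) := by
    funext x
    rcases htri x with hx | ⟨ρ, rfl⟩ | ⟨cs, rfl⟩
    · rw [hV2fixed x hx, kblockReducedRow_of_mem κ r i n Y _ hx]
    · rw [hV2B]
    · rw [hV2E]
  rw [hV2eq]
  exact hred

end Summit.ValiantsHypothesis.ValiantsHypothesis.Theorems.BarrierLever.MoorePeel
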